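import Summits.QuantumFields.YangMills.Theorems.QuantileBitPurityFluxRepresentation
import Summits.QuantumFields.YangMills.Theorems.QuantileBitPurityFluxReflectionOdd
import Summits.QuantumFields.YangMills.Theorems.QuantileBitPurityFluxReflectionEven
import Summits.QuantumFields.YangMills.Theorems.QuantileBitPuritySectorTwistBound
import Summits.QuantumFields.YangMills.Theorems.QuantileBitPuritySectorPinning
import Summits.QuantumFields.YangMills.Theorems.LuscherReductionRunningReductionOrbitDist
import Summits.QuantumFields.YangMills.Theorems.LuscherReductionOneSiteLevelsActionLipschitz
import Summits.QuantumFields.YangMills.Theorems.LuscherReductionOneSiteLevelsIMS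
import Literature.Analysis.FunctionSpaces.BMOCarlesonDuality
import HarnessLib

/-!
# Flux reflection on the lattice: the total weight of an `x`-twisted seam sector is controlled by PERIODIC-sector sign-flip weights

Support module (`--supports` stmt-QuantumFields-24093, `QuantileBitPurity.EquatorBandVanishing`; seat ym-dw-p1 g17, LINE g12-B of ideator seat ym-idea-4).
The electric-flux lever, instantiated: with `Ψ_q` the half-ring kernel (`QuantileBitPurityFluxHalfRing`), `K_β` the transfer kernel (positive semi-definite:
`qform_su2Rep_self_nonneg_of_bounded`), the centre twist `tw_z` of an `x`-twisted sector (`z 0 = true`, a measure-preserving involution) and the SIGN BIT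
`O(U) = sign Re tr P_x(U)` of the `x`-Polyakov holonomy (`O ∘ tw_z = −O`, `polyX_twist3`), the abstract reflection bound
(`FluxReflection.twisted_le_odd/even`) and the half-ring representation of seam sectors (`sectorWeight_eq_halfRing_odd/even`) give, for the ring of
`2q+3` (resp. `2q+2`) slices,

★ `sectorWeight_twisted_le_flip_odd` / `…_even`:
`W_z(1) ≤ √W_0(1)·(2√W_0(flip₀,ₘ · flip₀,ₘ₊₁) + √W_0(O(U₀)=0)) + W_0(band_m · band_{m+1}) + W_z(¬close_{m,m+1})`,

where `flip₀,ₘ = 𝟙{O(U_m) ≠ O(U_0)}`, `band = 𝟙{|Re tr P_x| ≤ τ}` (a sign flip across a linkwise `t`-close bond forces both slices into the band,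
`τ ≥ 2Lt`) and `W_0` is the UNTWISTED seam sector.  HONEST FRAMING: fixed-lattice transfer-matrix inequality; nothing about infinite volume, the
continuum limit or the Clay gap.  No `sorry`, no new axiom, no new definition.  References: [cite: tHooft1979]; [cite: Luscher1983, §2];
E. T. Tomboulis, L. G. Yaffe, CMP 100 (1985) 313 (the reflection idea behind `W_z ≤ W_0`).
-/

set_option autoImplicit false

noncomputable section

open MeasureTheory Filter Topology Real Function
open scoped BigOperators
open Literature.MathematicalPhysics.QuantumLattice
open Literature.MathematicalPhysics.QuantumFieldTheory hiding SU2
open Literature.Analysis.OperatorTheory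
open Summit.QuantumFields.YangMills.Theorems

namespace Summit.QuantumFields.YangMills.Theorems.FemtoTransferGap.TT

open Summit.QuantumFields.YangMills.Theorems.FemtoTransferGap
open Summit.QuantumFields.YangMills.Theorems.FemtoTransferGap.FlatSheet
open Summit.QuantumFields.YangMills.Theorems.FemtoTransferGap.TwoLattice.TowerA

variable {L : ℕ} [NeZero L]

/-! ## §1 The sign bit of the `x`-holonomy and the equator band `{|Re tr P_x| ≤ τ}` -/

/-- `U ↦ Re tr P_x(U)` is measurable (continuous). [folklore] -/
theorem measurable_reTrace_polyX : Measurable fun U : GaugeConfig 3 L SU2 => ((polyX U : SU2) : Matrix (Fin 2) (Fin 2) ℂ).trace.re := by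
  haveI := secondCountableTopology_su2
  have hc : Continuous fun U : GaugeConfig 3 L SU2 => ((polyX U : SU2) : Matrix (Fin 2) (Fin 2) ℂ).trace.re :=
    Complex.continuous_re.comp ((continuous_subtype_val.comp (continuous_polyXAux (L := L) L)).matrix_trace)
  exact hc.measurable

/-- The sign bit `O(U) = sign Re tr P_x(U)` is measurable. [folklore] -/
theorem measurable_signBit : Measurable fun U : GaugeConfig 3 L SU2 => Real.sign (((polyX U : SU2) : Matrix (Fin 2) (Fin 2) ℂ).trace.re) :=
  Literature.Analysis.FunctionSpaces.BMOInv.measurable_real_sign.comp measurable_reTrace_polyX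

/-- **The sign bit is ODD under an `x`-twist**: `O(tw_z U) = −O(U)` for `z 0 = true` (`P_x(tw_z U) = −P_x(U)`). [cite: tHooft1979] -/
theorem signBit_twist3 {z : Fin 3 → Bool} (hz : z 0 = true) (U : GaugeConfig 3 L SU2) :
    Real.sign (((polyX (twist3 z U) : SU2) : Matrix (Fin 2) (Fin 2) ℂ).trace.re) = -Real.sign (((polyX U : SU2) : Matrix (Fin 2) (Fin 2) ℂ).trace.re) := by
  rw [polyX_twist3, hz]
  simp [centreElem, Matrix.trace_neg, Real.sign_neg]

omit [NeZero L] in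
/-- The sign bit is gauge invariant. [cite: Luscher1983, §2] -/
theorem signBit_gaugeTransform (g : Site 3 L → SU2) (U : GaugeConfig 3 L SU2) :
    Real.sign (((polyX (gaugeTransform g U) : SU2) : Matrix (Fin 2) (Fin 2) ℂ).trace.re) = Real.sign (((polyX U : SU2) : Matrix (Fin 2) (Fin 2) ℂ).trace.re) := by
  rw [polyX_gaugeTransform]
  congr 2
  rw [Submonoid.coe_mul, Submonoid.coe_mul, Matrix.trace_mul_cycle, ← Submonoid.coe_mul, inv_mul_cancel, Submonoid.coe_one, Matrix.one_mul]

omit [NeZero L] in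
/-- `Re tr P_x` is gauge invariant. [cite: Luscher1983, §2] -/
theorem reTrace_polyX_gaugeTransform (g : Site 3 L → SU2) (U : GaugeConfig 3 L SU2) :
    ((polyX (gaugeTransform g U) : SU2) : Matrix (Fin 2) (Fin 2) ℂ).trace.re = ((polyX U : SU2) : Matrix (Fin 2) (Fin 2) ℂ).trace.re := by
  rw [polyX_gaugeTransform]
  congr 1
  rw [Submonoid.coe_mul, Submonoid.coe_mul, Matrix.trace_mul_cycle, ← Submonoid.coe_mul, inv_mul_cancel, Submonoid.coe_one, Matrix.one_mul]

omit [NeZero L] in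
/-- Different signs force smallness: `sign x ≠ sign y → |x| ≤ |x − y|`. [folklore] -/
theorem abs_le_abs_sub_of_sign_ne {x y : ℝ} (h : Real.sign x ≠ Real.sign y) : |x| ≤ |x - y| := by
  rcases lt_trichotomy x 0 with hx | hx | hx
  · rcases lt_trichotomy y 0 with hy | hy | hy
    · exact absurd (by rw [Real.sign_of_neg hx, Real.sign_of_neg hy]) h
    · subst hy; simp
    · rw [abs_of_neg hx, abs_of_neg (by linarith)]; linarith
  · subst hx; simp
  · rcases lt_trichotomy y 0 with hy | hy | hy
    · rw [abs_of_pos hx, abs_of_pos (by linarith)]; linarith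
    · subst hy; simp
    · exact absurd (by rw [Real.sign_of_pos hx, Real.sign_of_pos hy]) h

omit [NeZero L] in
/-- **A sign flip across a linkwise `t`-close pair sits in the equator band**: if every link of `a, a'` is `t`-close in Frobenius norm and
`O(a) ≠ O(a')`, then `|Re tr P_x(a)| ≤ 2Lt` and `|Re tr P_x(a')| ≤ 2Lt`. [cite: Luscher1983, §2] -/
theorem abs_reTrace_le_of_close_of_sign_ne {t : ℝ} {a a' : GaugeConfig 3 L SU2}
    (hclose : ∀ e : Edge 3 L, frobNorm (((a e : SU2) : Matrix (Fin 2) (Fin 2) ℂ) - ((a' e : SU2) : Matrix (Fin 2) (Fin 2) ℂ)) ≤ t)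
    (hne : Real.sign (((polyX a : SU2) : Matrix (Fin 2) (Fin 2) ℂ).trace.re) ≠ Real.sign (((polyX a' : SU2) : Matrix (Fin 2) (Fin 2) ℂ).trace.re)) :
    |((polyX a : SU2) : Matrix (Fin 2) (Fin 2) ℂ).trace.re| ≤ 2 * L * t ∧ |((polyX a' : SU2) : Matrix (Fin 2) (Fin 2) ℂ).trace.re| ≤ 2 * L * t := by
  have hdiff : |((polyX a : SU2) : Matrix (Fin 2) (Fin 2) ℂ).trace.re - ((polyX a' : SU2) : Matrix (Fin 2) (Fin 2) ℂ).trace.re| ≤ 2 * L * t := by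
    have h1 := frobNorm_polyXAux_sub_le a a' L
    have h2 : ∑ j ∈ Finset.range L, frobNorm ((a (lineEdge L j) : Matrix (Fin 2) (Fin 2) ℂ) - (a' (lineEdge L j) : Matrix (Fin 2) (Fin 2) ℂ)) ≤ L * t := by
      calc ∑ j ∈ Finset.range L, frobNorm ((a (lineEdge L j) : Matrix (Fin 2) (Fin 2) ℂ) - (a' (lineEdge L j) : Matrix (Fin 2) (Fin 2) ℂ))
          ≤ ∑ _j ∈ Finset.range L, t := Finset.sum_le_sum fun j _ => hclose _
        _ = L * t := by rw [Finset.sum_const, Finset.card_range, nsmul_eq_mul]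
    have h3 := abs_re_trace_le_two_mul_frobNorm (((polyX a : SU2) : Matrix (Fin 2) (Fin 2) ℂ) - ((polyX a' : SU2) : Matrix (Fin 2) (Fin 2) ℂ))
    rw [Matrix.trace_sub, Complex.sub_re] at h3
    have h4 : frobNorm (((polyX a : SU2) : Matrix (Fin 2) (Fin 2) ℂ) - ((polyX a' : SU2) : Matrix (Fin 2) (Fin 2) ℂ)) ≤ L * t := h1.trans h2
    linarith
  constructor
  · exact (abs_le_abs_sub_of_sign_ne hne).trans hdiff
  · rw [← abs_sub_comm] at hdiff
    exact (abs_le_abs_sub_of_sign_ne (Ne.symm hne)).trans hdiff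

/-- The equator band `{|Re tr P_x| ≤ τ}` is measurable. [folklore] -/
theorem measurableSet_reTraceBand (τ : ℝ) :
    MeasurableSet {U : GaugeConfig 3 L SU2 | |((polyX U : SU2) : Matrix (Fin 2) (Fin 2) ℂ).trace.re| ≤ τ} :=
  measurableSet_le measurable_reTrace_polyX.abs measurable_const

omit [NeZero L] in
/-- Gauge invariance of the flip indicator in its slice argument. [folklore] -/
theorem flipInd_gaugeTransform (g : Site 3 L → SU2) (x b : GaugeConfig 3 L SU2) :
    {b' : GaugeConfig 3 L SU2 | Real.sign (((polyX b' : SU2) : Matrix (Fin 2) (Fin 2) ℂ).trace.re) ≠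
        Real.sign (((polyX x : SU2) : Matrix (Fin 2) (Fin 2) ℂ).trace.re)}.indicator (fun _ => (1 : ℝ)) (gaugeTransform g b) =
      {b' : GaugeConfig 3 L SU2 | Real.sign (((polyX b' : SU2) : Matrix (Fin 2) (Fin 2) ℂ).trace.re) ≠
        Real.sign (((polyX x : SU2) : Matrix (Fin 2) (Fin 2) ℂ).trace.re)}.indicator (fun _ => (1 : ℝ)) b := by
  simp only [Set.indicator_apply, Set.mem_setOf_eq, signBit_gaugeTransform]

omit [NeZero L] in
/-- Gauge invariance of the band indicator. [folklore] -/
theorem bandInd_gaugeTransform (τ : ℝ) (g : Site 3 L → SU2) (b : GaugeConfig 3 L SU2) :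
    {U : GaugeConfig 3 L SU2 | |((polyX U : SU2) : Matrix (Fin 2) (Fin 2) ℂ).trace.re| ≤ τ}.indicator (fun _ => (1 : ℝ)) (gaugeTransform g b) =
      {U : GaugeConfig 3 L SU2 | |((polyX U : SU2) : Matrix (Fin 2) (Fin 2) ℂ).trace.re| ≤ τ}.indicator (fun _ => (1 : ℝ)) b := by
  simp only [Set.indicator_apply, Set.mem_setOf_eq, reTrace_polyX_gaugeTransform]

/-- Gauge invariance of the far-bond indicator. [folklore] -/
theorem farInd_gaugeTransform (t : ℝ) (g : Site 3 L → SU2) (a a' : GaugeConfig 3 L SU2) :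
    {p : GaugeConfig 3 L SU2 × GaugeConfig 3 L SU2 |
        ∃ e, t < frobNorm ((p.1 e : Matrix (Fin 2) (Fin 2) ℂ) - (p.2 e : Matrix (Fin 2) (Fin 2) ℂ))}ᶜᶜ.indicator (fun _ => (1 : ℝ))
        (gaugeTransform g a, gaugeTransform g a') =
      {p : GaugeConfig 3 L SU2 × GaugeConfig 3 L SU2 |
        ∃ e, t < frobNorm ((p.1 e : Matrix (Fin 2) (Fin 2) ℂ) - (p.2 e : Matrix (Fin 2) (Fin 2) ℂ))}ᶜᶜ.indicator (fun _ => (1 : ℝ)) (a, a') := by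
  simp only [compl_compl, Set.indicator_apply, Set.mem_setOf_eq, frobNorm_gaugeTransform_sub]

/-! ## §2 The odd ring: `W_z(1) ≤ √W_0(1)·(2√W_0(flip·flip) + √W_0(zero)) + W_0(band·band) + W_z(far)` -/

set_option maxHeartbeats 800000 in
/-- ★ **Flux reflection for an `x`-twisted seam sector, odd ring** of `2q+3` slices (written `1 + (q+1+q)`): the TOTAL weight of the sector `z`
(`z 0 = true`) is bounded by PERIODIC-sector weights of sign-flip events of the `x`-holonomy between slice `0` and the antipodal slices `q+1, q+2`,
of the zero-trace event at slice `0`, of the equator band `{|Re tr P_x| ≤ τ}` (`τ ≥ 2Lt`) at both antipodal slices, plus the twisted-sector weight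
of a `t`-far antipodal bond (`β ≥ 0`). [cite: tHooft1979] [cite: Luscher1983, §2] -/
theorem sectorWeight_twisted_le_flip_odd {β : ℝ} (hβ : 0 ≤ β) {z : Fin 3 → Bool} (hz : z 0 = true) (q : ℕ) {t τ : ℝ} (hτ : 2 * L * t ≤ τ) :
    sectorWeight (L := L) β (1 + (q + 1 + q)) z (fun _ _ => (1 : ℝ)) ≤
      Real.sqrt (sectorWeight (L := L) β (1 + (q + 1 + q)) (fun _ => false) (fun _ _ => (1 : ℝ))) *
          (2 * Real.sqrt (sectorWeight (L := L) β (1 + (q + 1 + q)) (fun _ => false) (fun Us _ =>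
              {b : GaugeConfig 3 L SU2 | Real.sign (((polyX b : SU2) : Matrix (Fin 2) (Fin 2) ℂ).trace.re) ≠
                  Real.sign (((polyX (Us 0) : SU2) : Matrix (Fin 2) (Fin 2) ℂ).trace.re)}.indicator (fun _ => (1 : ℝ)) (Us ⟨q + 1, by omega⟩) *
              {b : GaugeConfig 3 L SU2 | Real.sign (((polyX b : SU2) : Matrix (Fin 2) (Fin 2) ℂ).trace.re) ≠
                  Real.sign (((polyX (Us 0) : SU2) : Matrix (Fin 2) (Fin 2) ℂ).trace.re)}.indicator (fun _ => (1 : ℝ)) (Us ⟨q + 2, by omega⟩))) +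
            Real.sqrt (sectorWeight (L := L) β (1 + (q + 1 + q)) (fun _ => false) (fun Us _ =>
              {y : GaugeConfig 3 L SU2 | Real.sign (((polyX y : SU2) : Matrix (Fin 2) (Fin 2) ℂ).trace.re) = 0}.indicator (fun _ => (1 : ℝ)) (Us 0)))) +
        sectorWeight (L := L) β (1 + (q + 1 + q)) (fun _ => false) (fun Us _ =>
          {U : GaugeConfig 3 L SU2 | |((polyX U : SU2) : Matrix (Fin 2) (Fin 2) ℂ).trace.re| ≤ τ}.indicator (fun _ => (1 : ℝ)) (Us ⟨q + 1, by omega⟩) *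
          {U : GaugeConfig 3 L SU2 | |((polyX U : SU2) : Matrix (Fin 2) (Fin 2) ℂ).trace.re| ≤ τ}.indicator (fun _ => (1 : ℝ)) (Us ⟨q + 2, by omega⟩)) +
        sectorWeight (L := L) β (1 + (q + 1 + q)) z (fun Us _ =>
          {p : GaugeConfig 3 L SU2 × GaugeConfig 3 L SU2 |
            ∃ e, t < frobNorm ((p.1 e : Matrix (Fin 2) (Fin 2) ℂ) - (p.2 e : Matrix (Fin 2) (Fin 2) ℂ))}ᶜᶜ.indicator (fun _ => (1 : ℝ))
            (Us ⟨q + 1, by omega⟩, Us ⟨q + 2, by omega⟩)) := by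
  obtain ⟨M, hM0, hM⟩ := exists_abs_transferKernel_le (L := L) β
  set i₁ : Fin (1 + (q + 1 + q) + 1) := ⟨q + 1, by omega⟩ with hi₁
  set i₂ : Fin (1 + (q + 1 + q) + 1) := ⟨q + 2, by omega⟩ with hi₂
  have hi₁v : (i₁ : ℕ) = q + 1 := rfl
  have hi₂v : (i₂ : ℕ) = q + 2 := rfl
  -- the data of the abstract reflection bound
  have hΨm := measurable_iterate_section_uncurry (L := L) β q
  have hΨ0 : ∀ x a : GaugeConfig 3 L SU2, 0 ≤ ((fun f : GaugeConfig 3 L SU2 → ℝ => fun U => ∫ V, gaugeKernel β U V * f V ∂configMeasure SU2 L)^[q]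
      (fun w => gaugeKernel β w a)) x := fun x a => (iterate_section_nonneg_le hM q a x).1
  have hΨb : ∀ x a : GaugeConfig 3 L SU2, |((fun f : GaugeConfig 3 L SU2 → ℝ => fun U => ∫ V, gaugeKernel β U V * f V ∂configMeasure SU2 L)^[q]
      (fun w => gaugeKernel β w a)) x| ≤ M ^ (q + 1) := fun x a => by
    rw [abs_of_nonneg (hΨ0 x a)]; exact (iterate_section_nonneg_le hM q a x).2
  have hΨs := iterate_section_symm (L := L) hM q
  have hKm : Measurable (uncurry (transferKernel (L := L) su2Rep β)) := (PhysL2.stronglyMeasurable_transferKernel (L := L) β).measurable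
  have hK0 : ∀ a a' : GaugeConfig 3 L SU2, 0 ≤ transferKernel su2Rep β a a' := fun a a' => (transferKernel_pos _ _ _ _).le
  have hKs : ∀ a a' : GaugeConfig 3 L SU2, transferKernel su2Rep β a a' = transferKernel su2Rep β a' a := transferKernel_su2Rep_symm β
  have hPD : ∀ φ : GaugeConfig 3 L SU2 → ℝ, Measurable φ → ∀ C : ℝ, (∀ a, |φ a| ≤ C) →
      0 ≤ ∫ a, ∫ a', φ a * transferKernel su2Rep β a a' * φ a' ∂configMeasure SU2 L ∂configMeasure SU2 L :=
    fun φ hφ C hC => qform_su2Rep_self_nonneg_of_bounded (L := L) hβ hφ hC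
  have hT := measurePreserving_twist3 (L := L) z
  have hOm := measurable_signBit (L := L)
  have hOT := signBit_twist3 (L := L) hz
  have hB := measurableSet_reTraceBand (L := L) τ
  have hCl := (FlatSheet.measurableSet_far (L := L) t).compl
  have hflip : ∀ a a' : GaugeConfig 3 L SU2,
      (a, a') ∈ ({p : GaugeConfig 3 L SU2 × GaugeConfig 3 L SU2 |
        ∃ e, t < frobNorm ((p.1 e : Matrix (Fin 2) (Fin 2) ℂ) - (p.2 e : Matrix (Fin 2) (Fin 2) ℂ))}ᶜ) →
      Real.sign (((polyX a : SU2) : Matrix (Fin 2) (Fin 2) ℂ).trace.re) ≠ Real.sign (((polyX a' : SU2) : Matrix (Fin 2) (Fin 2) ℂ).trace.re) →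
      a ∈ {U : GaugeConfig 3 L SU2 | |((polyX U : SU2) : Matrix (Fin 2) (Fin 2) ℂ).trace.re| ≤ τ} ∧
        a' ∈ {U : GaugeConfig 3 L SU2 | |((polyX U : SU2) : Matrix (Fin 2) (Fin 2) ℂ).trace.re| ≤ τ} := by
    intro a a' hmem hne
    have hclose : ∀ e : Edge 3 L, frobNorm (((a e : SU2) : Matrix (Fin 2) (Fin 2) ℂ) - ((a' e : SU2) : Matrix (Fin 2) (Fin 2) ℂ)) ≤ t := by
      intro e
      by_contra h
      exact hmem ⟨e, lt_of_not_ge h⟩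
    obtain ⟨h1, h2⟩ := abs_reTrace_le_of_close_of_sign_ne hclose hne
    exact ⟨h1.trans hτ, h2.trans hτ⟩
  have key := FluxReflection.twisted_le_odd (ρ := configMeasure SU2 L)
    (Ψ := fun x a : GaugeConfig 3 L SU2 => ((fun f : GaugeConfig 3 L SU2 → ℝ => fun U => ∫ V, gaugeKernel β U V * f V ∂configMeasure SU2 L)^[q]
      (fun w => gaugeKernel β w a)) x)
    (K := transferKernel (L := L) su2Rep β) hΨm hΨb hΨ0 hΨs hKm hM hK0 hKs hPD hT hOm hOT hB hCl hflip
  -- the six ring weights as seam-sector weights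
  have hH1m : Measurable fun p : GaugeConfig 3 L SU2 × GaugeConfig 3 L SU2 × GaugeConfig 3 L SU2 => (1 : ℝ) := measurable_const
  have e0 : sectorWeight (L := L) β (1 + (q + 1 + q)) z (fun _ _ => (1 : ℝ)) =
      ∫ x, ∫ a, ((fun f : GaugeConfig 3 L SU2 → ℝ => fun U => ∫ V, gaugeKernel β U V * f V ∂configMeasure SU2 L)^[q] (fun w => gaugeKernel β w a)) x *
        ∫ a', transferKernel su2Rep β a a' *
          ((fun f : GaugeConfig 3 L SU2 → ℝ => fun U => ∫ V, gaugeKernel β U V * f V ∂configMeasure SU2 L)^[q] (fun w => gaugeKernel β w (twist3 z x))) a'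
          ∂configMeasure SU2 L ∂configMeasure SU2 L ∂configMeasure SU2 L := by
    rw [sectorWeight_eq_halfRing_odd (L := L) hM q z (H := fun _ _ _ => (1 : ℝ)) (CH := 1) hH1m (fun _ _ _ => by simp) (fun _ _ _ _ => rfl) i₁ i₂ hi₁v hi₂v]
    simp only [mul_one]
  have e1 : sectorWeight (L := L) β (1 + (q + 1 + q)) (fun _ => false) (fun _ _ => (1 : ℝ)) =
      ∫ x, ∫ a, ((fun f : GaugeConfig 3 L SU2 → ℝ => fun U => ∫ V, gaugeKernel β U V * f V ∂configMeasure SU2 L)^[q] (fun w => gaugeKernel β w a)) x * ∫ a', transferKernel su2Rep β a a' * ((fun f : GaugeConfig 3 L SU2 → ℝ => fun U => ∫ V, gaugeKernel β U V * f V ∂configMeasure SU2 L)^[q] (fun w => gaugeKernel β w x)) a' ∂configMeasure SU2 L ∂configMeasure SU2 L ∂configMeasure SU2 L := by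
    rw [sectorWeight_eq_halfRing_odd (L := L) hM q (fun _ => false) (H := fun _ _ _ => (1 : ℝ)) (CH := 1) hH1m (fun _ _ _ => by simp)
      (fun _ _ _ _ => rfl) i₁ i₂ hi₁v hi₂v]
    simp only [mul_one, twist3_false]
  -- flip
  have pr1 : Measurable fun p : GaugeConfig 3 L SU2 × GaugeConfig 3 L SU2 × GaugeConfig 3 L SU2 => p.1 := measurable_fst
  have pr2 : Measurable fun p : GaugeConfig 3 L SU2 × GaugeConfig 3 L SU2 × GaugeConfig 3 L SU2 => p.2.1 := measurable_fst.comp measurable_snd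
  have pr3 : Measurable fun p : GaugeConfig 3 L SU2 × GaugeConfig 3 L SU2 × GaugeConfig 3 L SU2 => p.2.2 := measurable_snd.comp measurable_snd
  have hflm : Measurable fun p : GaugeConfig 3 L SU2 × GaugeConfig 3 L SU2 × GaugeConfig 3 L SU2 =>
      {b : GaugeConfig 3 L SU2 | Real.sign (((polyX b : SU2) : Matrix (Fin 2) (Fin 2) ℂ).trace.re) ≠ Real.sign (((polyX p.1 : SU2) : Matrix (Fin 2) (Fin 2) ℂ).trace.re)}.indicator (fun _ => (1 : ℝ)) p.2.1 * {b : GaugeConfig 3 L SU2 | Real.sign (((polyX b : SU2) : Matrix (Fin 2) (Fin 2) ℂ).trace.re) ≠ Real.sign (((polyX p.1 : SU2) : Matrix (Fin 2) (Fin 2) ℂ).trace.re)}.indicator (fun _ => (1 : ℝ)) p.2.2 := by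
    have h1 := (FluxReflection.measurable_flipInd hOm).comp (pr1.prodMk pr2)
    have h2 := (FluxReflection.measurable_flipInd hOm).comp (pr1.prodMk pr3)
    exact h1.mul h2
  have hflb : ∀ x a a' : GaugeConfig 3 L SU2, |{b : GaugeConfig 3 L SU2 | Real.sign (((polyX b : SU2) : Matrix (Fin 2) (Fin 2) ℂ).trace.re) ≠ Real.sign (((polyX x : SU2) : Matrix (Fin 2) (Fin 2) ℂ).trace.re)}.indicator (fun _ => (1 : ℝ)) a * {b : GaugeConfig 3 L SU2 | Real.sign (((polyX b : SU2) : Matrix (Fin 2) (Fin 2) ℂ).trace.re) ≠ Real.sign (((polyX x : SU2) : Matrix (Fin 2) (Fin 2) ℂ).trace.re)}.indicator (fun _ => (1 : ℝ)) a'| ≤ 1 := fun x a a' => by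
    rw [abs_mul]
    exact (mul_le_mul (FluxReflection.abs_ind_le_one _ _) (FluxReflection.abs_ind_le_one _ _) (abs_nonneg _) zero_le_one).trans (by rw [mul_one])
  have eflip : sectorWeight (L := L) β (1 + (q + 1 + q)) (fun _ => false) (fun Us _ => {b : GaugeConfig 3 L SU2 | Real.sign (((polyX b : SU2) : Matrix (Fin 2) (Fin 2) ℂ).trace.re) ≠ Real.sign (((polyX (Us 0) : SU2) : Matrix (Fin 2) (Fin 2) ℂ).trace.re)}.indicator (fun _ => (1 : ℝ)) (Us i₁) * {b : GaugeConfig 3 L SU2 | Real.sign (((polyX b : SU2) : Matrix (Fin 2) (Fin 2) ℂ).trace.re) ≠ Real.sign (((polyX (Us 0) : SU2) : Matrix (Fin 2) (Fin 2) ℂ).trace.re)}.indicator (fun _ => (1 : ℝ)) (Us i₂)) =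
      ∫ x, ∫ a, ((fun f : GaugeConfig 3 L SU2 → ℝ => fun U => ∫ V, gaugeKernel β U V * f V ∂configMeasure SU2 L)^[q] (fun w => gaugeKernel β w a)) x * ∫ a', transferKernel su2Rep β a a' * ({b : GaugeConfig 3 L SU2 | Real.sign (((polyX b : SU2) : Matrix (Fin 2) (Fin 2) ℂ).trace.re) ≠ Real.sign (((polyX x : SU2) : Matrix (Fin 2) (Fin 2) ℂ).trace.re)}.indicator (fun _ => (1 : ℝ)) a * {b : GaugeConfig 3 L SU2 | Real.sign (((polyX b : SU2) : Matrix (Fin 2) (Fin 2) ℂ).trace.re) ≠ Real.sign (((polyX x : SU2) : Matrix (Fin 2) (Fin 2) ℂ).trace.re)}.indicator (fun _ => (1 : ℝ)) a') * ((fun f : GaugeConfig 3 L SU2 → ℝ => fun U => ∫ V, gaugeKernel β U V * f V ∂configMeasure SU2 L)^[q] (fun w => gaugeKernel β w x)) a'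
        ∂configMeasure SU2 L ∂configMeasure SU2 L ∂configMeasure SU2 L := by
    rw [sectorWeight_eq_halfRing_odd (L := L) hM q (fun _ => false)
      (H := fun x a a' => {b : GaugeConfig 3 L SU2 | Real.sign (((polyX b : SU2) : Matrix (Fin 2) (Fin 2) ℂ).trace.re) ≠ Real.sign (((polyX x : SU2) : Matrix (Fin 2) (Fin 2) ℂ).trace.re)}.indicator (fun _ => (1 : ℝ)) a * {b : GaugeConfig 3 L SU2 | Real.sign (((polyX b : SU2) : Matrix (Fin 2) (Fin 2) ℂ).trace.re) ≠ Real.sign (((polyX x : SU2) : Matrix (Fin 2) (Fin 2) ℂ).trace.re)}.indicator (fun _ => (1 : ℝ)) a') (CH := 1) hflm hflb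
      (fun g x a a' => by rw [flipInd_gaugeTransform, flipInd_gaugeTransform]) i₁ i₂ hi₁v hi₂v]
    simp only [twist3_false]
  -- zero
  have hzm : Measurable fun p : GaugeConfig 3 L SU2 × GaugeConfig 3 L SU2 × GaugeConfig 3 L SU2 => {y : GaugeConfig 3 L SU2 | Real.sign (((polyX y : SU2) : Matrix (Fin 2) (Fin 2) ℂ).trace.re) = 0}.indicator (fun _ => (1 : ℝ)) p.1 :=
    (measurable_const.indicator (measurableSet_eq_fun hOm measurable_const)).comp pr1
  have ezero : sectorWeight (L := L) β (1 + (q + 1 + q)) (fun _ => false) (fun Us _ => {y : GaugeConfig 3 L SU2 | Real.sign (((polyX y : SU2) : Matrix (Fin 2) (Fin 2) ℂ).trace.re) = 0}.indicator (fun _ => (1 : ℝ)) (Us 0)) =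
      ∫ x, ∫ a, ((fun f : GaugeConfig 3 L SU2 → ℝ => fun U => ∫ V, gaugeKernel β U V * f V ∂configMeasure SU2 L)^[q] (fun w => gaugeKernel β w a)) x * ∫ a', transferKernel su2Rep β a a' * {y : GaugeConfig 3 L SU2 | Real.sign (((polyX y : SU2) : Matrix (Fin 2) (Fin 2) ℂ).trace.re) = 0}.indicator (fun _ => (1 : ℝ)) x * ((fun f : GaugeConfig 3 L SU2 → ℝ => fun U => ∫ V, gaugeKernel β U V * f V ∂configMeasure SU2 L)^[q] (fun w => gaugeKernel β w x)) a'
        ∂configMeasure SU2 L ∂configMeasure SU2 L ∂configMeasure SU2 L := by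
    rw [sectorWeight_eq_halfRing_odd (L := L) hM q (fun _ => false) (H := fun x _ _ => {y : GaugeConfig 3 L SU2 | Real.sign (((polyX y : SU2) : Matrix (Fin 2) (Fin 2) ℂ).trace.re) = 0}.indicator (fun _ => (1 : ℝ)) x) (CH := 1) hzm
      (fun _ _ _ => FluxReflection.abs_ind_le_one _ _) (fun _ _ _ _ => rfl) i₁ i₂ hi₁v hi₂v]
    simp only [twist3_false]
  -- band
  have hbm : Measurable fun p : GaugeConfig 3 L SU2 × GaugeConfig 3 L SU2 × GaugeConfig 3 L SU2 => {U : GaugeConfig 3 L SU2 | |((polyX U : SU2) : Matrix (Fin 2) (Fin 2) ℂ).trace.re| ≤ τ}.indicator (fun _ => (1 : ℝ)) p.2.1 * {U : GaugeConfig 3 L SU2 | |((polyX U : SU2) : Matrix (Fin 2) (Fin 2) ℂ).trace.re| ≤ τ}.indicator (fun _ => (1 : ℝ)) p.2.2 :=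
    ((measurable_const.indicator hB).comp pr2).mul ((measurable_const.indicator hB).comp pr3)
  have hbb : ∀ x a a' : GaugeConfig 3 L SU2, |{U : GaugeConfig 3 L SU2 | |((polyX U : SU2) : Matrix (Fin 2) (Fin 2) ℂ).trace.re| ≤ τ}.indicator (fun _ => (1 : ℝ)) a * {U : GaugeConfig 3 L SU2 | |((polyX U : SU2) : Matrix (Fin 2) (Fin 2) ℂ).trace.re| ≤ τ}.indicator (fun _ => (1 : ℝ)) a'| ≤ 1 := fun x a a' => by
    rw [abs_mul]
    exact (mul_le_mul (FluxReflection.abs_ind_le_one _ _) (FluxReflection.abs_ind_le_one _ _) (abs_nonneg _) zero_le_one).trans (by rw [mul_one])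
  have eband : sectorWeight (L := L) β (1 + (q + 1 + q)) (fun _ => false) (fun Us _ => {U : GaugeConfig 3 L SU2 | |((polyX U : SU2) : Matrix (Fin 2) (Fin 2) ℂ).trace.re| ≤ τ}.indicator (fun _ => (1 : ℝ)) (Us i₁) * {U : GaugeConfig 3 L SU2 | |((polyX U : SU2) : Matrix (Fin 2) (Fin 2) ℂ).trace.re| ≤ τ}.indicator (fun _ => (1 : ℝ)) (Us i₂)) =
      ∫ x, ∫ a, ((fun f : GaugeConfig 3 L SU2 → ℝ => fun U => ∫ V, gaugeKernel β U V * f V ∂configMeasure SU2 L)^[q] (fun w => gaugeKernel β w a)) x * ∫ a', transferKernel su2Rep β a a' * ({U : GaugeConfig 3 L SU2 | |((polyX U : SU2) : Matrix (Fin 2) (Fin 2) ℂ).trace.re| ≤ τ}.indicator (fun _ => (1 : ℝ)) a * {U : GaugeConfig 3 L SU2 | |((polyX U : SU2) : Matrix (Fin 2) (Fin 2) ℂ).trace.re| ≤ τ}.indicator (fun _ => (1 : ℝ)) a') * ((fun f : GaugeConfig 3 L SU2 → ℝ => fun U => ∫ V, gaugeKernel β U V * f V ∂configMeasure SU2 L)^[q]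 (fun w => gaugeKernel β w x)) a'
        ∂configMeasure SU2 L ∂configMeasure SU2 L ∂configMeasure SU2 L := by
    rw [sectorWeight_eq_halfRing_odd (L := L) hM q (fun _ => false) (H := fun _ a a' => {U : GaugeConfig 3 L SU2 | |((polyX U : SU2) : Matrix (Fin 2) (Fin 2) ℂ).trace.re| ≤ τ}.indicator (fun _ => (1 : ℝ)) a * {U : GaugeConfig 3 L SU2 | |((polyX U : SU2) : Matrix (Fin 2) (Fin 2) ℂ).trace.re| ≤ τ}.indicator (fun _ => (1 : ℝ)) a') (CH := 1) hbm hbb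
      (fun g x a a' => by rw [bandInd_gaugeTransform, bandInd_gaugeTransform]) i₁ i₂ hi₁v hi₂v]
    simp only [twist3_false]
  -- far bond
  have hfm : Measurable fun p : GaugeConfig 3 L SU2 × GaugeConfig 3 L SU2 × GaugeConfig 3 L SU2 => {p : GaugeConfig 3 L SU2 × GaugeConfig 3 L SU2 | ∃ e, t < frobNorm ((p.1 e : Matrix (Fin 2) (Fin 2) ℂ) - (p.2 e : Matrix (Fin 2) (Fin 2) ℂ))}ᶜᶜ.indicator (fun _ => (1 : ℝ)) (p.2.1, p.2.2) :=
    (measurable_const.indicator hCl.compl).comp (pr2.prodMk pr3)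
  have ebad : sectorWeight (L := L) β (1 + (q + 1 + q)) z (fun Us _ => {p : GaugeConfig 3 L SU2 × GaugeConfig 3 L SU2 | ∃ e, t < frobNorm ((p.1 e : Matrix (Fin 2) (Fin 2) ℂ) - (p.2 e : Matrix (Fin 2) (Fin 2) ℂ))}ᶜᶜ.indicator (fun _ => (1 : ℝ)) (Us i₁, Us i₂)) =
      ∫ x, ∫ a, ((fun f : GaugeConfig 3 L SU2 → ℝ => fun U => ∫ V, gaugeKernel β U V * f V ∂configMeasure SU2 L)^[q] (fun w => gaugeKernel β w a)) x * ∫ a', transferKernel su2Rep β a a' * {p : GaugeConfig 3 L SU2 × GaugeConfig 3 L SU2 | ∃ e, t < frobNorm ((p.1 e : Matrix (Fin 2) (Fin 2) ℂ) - (p.2 e : Matrix (Fin 2) (Fin 2) ℂ))}ᶜᶜ.indicator (fun _ => (1 : ℝ)) (a, a') * ((fun f : GaugeConfig 3 L SU2 → ℝ => fun U => ∫ V, gaugeKernel β U V * f V ∂configMeasure SU2 L)^[q] (fun w => gaugeKernel β w (twist3 z x))) a'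
        ∂configMeasure SU2 L ∂configMeasure SU2 L ∂configMeasure SU2 L :=
    sectorWeight_eq_halfRing_odd (L := L) hM q z (H := fun _ a a' => {p : GaugeConfig 3 L SU2 × GaugeConfig 3 L SU2 | ∃ e, t < frobNorm ((p.1 e : Matrix (Fin 2) (Fin 2) ℂ) - (p.2 e : Matrix (Fin 2) (Fin 2) ℂ))}ᶜᶜ.indicator (fun _ => (1 : ℝ)) (a, a')) (CH := 1) hfm
      (fun _ a a' => FluxReflection.abs_ind_le_one (Y := GaugeConfig 3 L SU2 × GaugeConfig 3 L SU2) _ (a, a'))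
      (fun g x a a' => farInd_gaugeTransform t g a a') i₁ i₂ hi₁v hi₂v
  rw [← e0, ← e1, ← eflip, ← ezero, ← eband, ← ebad] at key
  exact key

/-! ## §3 The even ring: `W_z(1) ≤ √W_0(1)·(2√W_0(flip) + √W_0(zero))` -/

set_option maxHeartbeats 800000 in
/-- ★ **Flux reflection for an `x`-twisted seam sector, even ring** of `2q+2` slices (written `1 + (q+q)`): the total weight of the sector `z`
(`z 0 = true`) is bounded by periodic-sector weights of the sign-flip event between slice `0` and the antipodal slice `q+1` and of the zero-trace
event at slice `0` (no middle bond, no band term, no positivity needed). [cite: tHooft1979] [cite: Luscher1983, §2] -/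
theorem sectorWeight_twisted_le_flip_even (β : ℝ) {z : Fin 3 → Bool} (hz : z 0 = true) (q : ℕ) :
    sectorWeight (L := L) β (1 + (q + q)) z (fun _ _ => (1 : ℝ)) ≤
      Real.sqrt (sectorWeight (L := L) β (1 + (q + q)) (fun _ => false) (fun _ _ => (1 : ℝ))) *
        (2 * Real.sqrt (sectorWeight (L := L) β (1 + (q + q)) (fun _ => false) (fun Us _ => {b : GaugeConfig 3 L SU2 | Real.sign (((polyX b : SU2) : Matrix (Fin 2) (Fin 2) ℂ).trace.re) ≠ Real.sign (((polyX (Us 0) : SU2) : Matrix (Fin 2) (Fin 2) ℂ).trace.re)}.indicator (fun _ => (1 : ℝ)) (Us ⟨q + 1, by omega⟩))) +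
          Real.sqrt (sectorWeight (L := L) β (1 + (q + q)) (fun _ => false) (fun Us _ => {y : GaugeConfig 3 L SU2 | Real.sign (((polyX y : SU2) : Matrix (Fin 2) (Fin 2) ℂ).trace.re) = 0}.indicator (fun _ => (1 : ℝ)) (Us 0)))) := by
  obtain ⟨M, hM0, hM⟩ := exists_abs_transferKernel_le (L := L) β
  set i₁ : Fin (1 + (q + q) + 1) := ⟨q + 1, by omega⟩ with hi₁
  have hi₁v : (i₁ : ℕ) = q + 1 := rfl
  have hΨm := measurable_iterate_section_uncurry (L := L) β q
  have hΨ0 : ∀ x a : GaugeConfig 3 L SU2, 0 ≤ ((fun f : GaugeConfig 3 L SU2 → ℝ => fun U => ∫ V, gaugeKernel β U V * f V ∂configMeasure SU2 L)^[q]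
      (fun w => gaugeKernel β w a)) x := fun x a => (iterate_section_nonneg_le hM q a x).1
  have hΨb : ∀ x a : GaugeConfig 3 L SU2, |((fun f : GaugeConfig 3 L SU2 → ℝ => fun U => ∫ V, gaugeKernel β U V * f V ∂configMeasure SU2 L)^[q]
      (fun w => gaugeKernel β w a)) x| ≤ M ^ (q + 1) := fun x a => by
    rw [abs_of_nonneg (hΨ0 x a)]; exact (iterate_section_nonneg_le hM q a x).2
  have hΨs := iterate_section_symm (L := L) hM q
  have hT := measurePreserving_twist3 (L := L) z
  have hOm := measurable_signBit (L := L)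
  have hOT := signBit_twist3 (L := L) hz
  have key := FluxReflection.twisted_le_even (ρ := configMeasure SU2 L)
    (Ψ := fun x a : GaugeConfig 3 L SU2 => ((fun f : GaugeConfig 3 L SU2 → ℝ => fun U => ∫ V, gaugeKernel β U V * f V ∂configMeasure SU2 L)^[q]
      (fun w => gaugeKernel β w a)) x) hΨm hΨb hΨ0 hΨs hT hOm hOT
  have hH1m : Measurable (uncurry fun _ _ : GaugeConfig 3 L SU2 => (1 : ℝ)) := measurable_const
  have e0 : sectorWeight (L := L) β (1 + (q + q)) z (fun _ _ => (1 : ℝ)) = ∫ x, ∫ a, ((fun f : GaugeConfig 3 L SU2 → ℝ => fun U => ∫ V, gaugeKernel β U V * f V ∂configMeasure SU2 L)^[q] (fun w => gaugeKernel β w a)) x * ((fun f : GaugeConfig 3 L SU2 → ℝ => fun U => ∫ V, gaugeKernel β U V * f V ∂configMeasure SU2 L)^[q] (fun w => gaugeKernel β w (twist3 z x))) a ∂configMeasure SU2 L ∂configMeasure SU2 L := by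
    rw [sectorWeight_eq_halfRing_even (L := L) hM q z (H := fun _ _ => (1 : ℝ)) (CH := 1) hH1m (fun _ _ => by simp) (fun _ _ _ => rfl) i₁ hi₁v]
    simp only [mul_one]
  have e1 : sectorWeight (L := L) β (1 + (q + q)) (fun _ => false) (fun _ _ => (1 : ℝ)) = ∫ x, ∫ a, ((fun f : GaugeConfig 3 L SU2 → ℝ => fun U => ∫ V, gaugeKernel β U V * f V ∂configMeasure SU2 L)^[q] (fun w => gaugeKernel β w a)) x * ((fun f : GaugeConfig 3 L SU2 → ℝ => fun U => ∫ V, gaugeKernel β U V * f V ∂configMeasure SU2 L)^[q] (fun w => gaugeKernel β w x)) a ∂configMeasure SU2 L ∂configMeasure SU2 L := by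
    rw [sectorWeight_eq_halfRing_even (L := L) hM q (fun _ => false) (H := fun _ _ => (1 : ℝ)) (CH := 1) hH1m (fun _ _ => by simp) (fun _ _ _ => rfl) i₁ hi₁v]
    simp only [mul_one, twist3_false]
  have hflm : Measurable (uncurry fun x b : GaugeConfig 3 L SU2 => {b : GaugeConfig 3 L SU2 | Real.sign (((polyX b : SU2) : Matrix (Fin 2) (Fin 2) ℂ).trace.re) ≠ Real.sign (((polyX x : SU2) : Matrix (Fin 2) (Fin 2) ℂ).trace.re)}.indicator (fun _ => (1 : ℝ)) b) := FluxReflection.measurable_flipInd hOm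
  have eflip : sectorWeight (L := L) β (1 + (q + q)) (fun _ => false) (fun Us _ => {b : GaugeConfig 3 L SU2 | Real.sign (((polyX b : SU2) : Matrix (Fin 2) (Fin 2) ℂ).trace.re) ≠ Real.sign (((polyX (Us 0) : SU2) : Matrix (Fin 2) (Fin 2) ℂ).trace.re)}.indicator (fun _ => (1 : ℝ)) (Us i₁)) =
      ∫ x, ∫ a, ((fun f : GaugeConfig 3 L SU2 → ℝ => fun U => ∫ V, gaugeKernel β U V * f V ∂configMeasure SU2 L)^[q] (fun w => gaugeKernel β w a)) x * {b : GaugeConfig 3 L SU2 | Real.sign (((polyX b : SU2) : Matrix (Fin 2) (Fin 2) ℂ).trace.re) ≠ Real.sign (((polyX x : SU2) : Matrix (Fin 2) (Fin 2) ℂ).trace.re)}.indicator (fun _ => (1 : ℝ)) a * ((fun f : GaugeConfig 3 L SU2 → ℝ => fun U => ∫ V, gaugeKernel β U V * f V ∂configMeasure SU2 L)^[q] (fun w => gaugeKernel β w x)) a ∂configMeasure SU2 L ∂configMeasure SU2 L := by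
    rw [sectorWeight_eq_halfRing_even (L := L) hM q (fun _ => false) (H := fun x b => {b : GaugeConfig 3 L SU2 | Real.sign (((polyX b : SU2) : Matrix (Fin 2) (Fin 2) ℂ).trace.re) ≠ Real.sign (((polyX x : SU2) : Matrix (Fin 2) (Fin 2) ℂ).trace.re)}.indicator (fun _ => (1 : ℝ)) b) (CH := 1) hflm
      (fun _ _ => FluxReflection.abs_ind_le_one _ _) (fun g x b => flipInd_gaugeTransform g x b) i₁ hi₁v]
    simp only [twist3_false]
  have hzm : Measurable (uncurry fun x _ : GaugeConfig 3 L SU2 => {y : GaugeConfig 3 L SU2 | Real.sign (((polyX y : SU2) : Matrix (Fin 2) (Fin 2) ℂ).trace.re) = 0}.indicator (fun _ => (1 : ℝ)) x) :=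
    (measurable_const.indicator (measurableSet_eq_fun hOm measurable_const)).comp measurable_fst
  have ezero : sectorWeight (L := L) β (1 + (q + q)) (fun _ => false) (fun Us _ => {y : GaugeConfig 3 L SU2 | Real.sign (((polyX y : SU2) : Matrix (Fin 2) (Fin 2) ℂ).trace.re) = 0}.indicator (fun _ => (1 : ℝ)) (Us 0)) =
      ∫ x, ∫ a, ((fun f : GaugeConfig 3 L SU2 → ℝ => fun U => ∫ V, gaugeKernel β U V * f V ∂configMeasure SU2 L)^[q] (fun w => gaugeKernel β w a)) x * {y : GaugeConfig 3 L SU2 | Real.sign (((polyX y : SU2) : Matrix (Fin 2) (Fin 2) ℂ).trace.re) = 0}.indicator (fun _ => (1 : ℝ)) x * ((fun f : GaugeConfig 3 L SU2 → ℝ => fun U => ∫ V, gaugeKernel β U V * f V ∂configMeasure SU2 L)^[q] (fun w => gaugeKernel β w x)) a ∂configMeasure SU2 L ∂configMeasure SU2 L := by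
    rw [sectorWeight_eq_halfRing_even (L := L) hM q (fun _ => false) (H := fun x _ => {y : GaugeConfig 3 L SU2 | Real.sign (((polyX y : SU2) : Matrix (Fin 2) (Fin 2) ℂ).trace.re) = 0}.indicator (fun _ => (1 : ℝ)) x) (CH := 1) hzm
      (fun _ _ => FluxReflection.abs_ind_le_one _ _) (fun _ _ _ => rfl) i₁ hi₁v]
    simp only [twist3_false]
  rw [← e0, ← e1, ← eflip, ← ezero] at key
  exact key

end Summit.QuantumFields.YangMills.Theorems.FemtoTransferGap.TT

end
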